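import Literature.MathematicalPhysics.QuantumFieldTheory.Balaban1983to89.B9Cor36GDirCutWindows
import Literature.MathematicalPhysics.QuantumFieldTheory.Balaban1983to89.B9Ineq373FirstOrderCommY

/-!
# `Balaban1983to89.B9Cor36GDirCutWindowsThree` — [Balaban1985BackgroundPropagators] Cor. 3.6 p. 408 AT ONE COVER CUBE: THE (3.37) WINDOWS OF THE SHARP-CUT SMALL
# FIELD `Ṽ = cutCfgS i T η A` IN THE DISTANCE-3 BLOCK NEIGHBOURHOOD, and the two first-order COMMUTATOR letters `[V¹_μ(Ṽ), ∇_ν]`, `[P¹_μ(Ṽ), ∇_ν]` of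
# `Δ_{loc,□}(1) − Δ_{loc,□}(Ṽ)` as ZEROTH-ORDER majorants of (3.73)-size `O(1)·α_T·(Lⁿη)⁻²` over the cube sequence's blocks (F3 ✓`B9Cor36GDirCutWindows` at block
# distance `≤ 3` + G-F8a ✓`B9Ineq373FirstOrderCommY` BY NAME) — seat dag-n06-c g36, FILE R2 of «E2 BY NAME» (the right entry (3.42)₃ of the Dirichlet bond letter
# of record; cell GAPS G-B9-02): the windows the divergence-form reading of the perturbation word asks

statement-level skeleton of published theorems with citation tags; proofs where landed; nothing here is a claim about the Yang–Mills mass gap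

CITATION HEADER (lean-in-tree rule).  B9 = T. Bałaban, *Propagators for lattice gauge theories in a background field*, Commun. Math. Phys. **99** (1985)
389–434 [Balaban1985BackgroundPropagators] (held `paper:balaban1985-cmp99-background-propagators`; journal page = PDF page + 388): Cor. 3.6 p. 408 l. 1–14 («U′
satisfies (3.37) for the sequence {Ω′_j} with U = 1 and α₁ = O(1)Mα₀»); (3.37) p. 396 («|A′| < α₁(Lʲη)⁻¹, |∇^η_UA′| < α₁(Lʲη)⁻² on Ω_j»); (3.73) p. 405; p. 407 («The
operator V₃(A) is a local differential operator of the first order satisfying the bound (3.73)»); p. 398 l. 20–24 («we may always replace ∇_U by ∇*_U, and vice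
versa»); (3.69) p. 404.  [4] = [Balaban1984PropagatorsII] (2.2) p. 224, Lemma 2.1 (2.60) p. 234, (2.51) p. 232.  Rows B9.Cor3.6 × B9.Eq3.37 × B9.Eq3.73 (cells only;
no row head changes).

WHY THIS FILE (cell `pub-ymgap`, node N06 [B9]; road (B5), the right entry).  The (3.86) transfer of the RIGHT entry `G_□(Ṽ)∇*_ν` needs the small letter `G_□(1)·V`
with `G_□(1)` on the LEFT of the perturbation word `V = Z + Σ_μ W_μ∇_μ` (p38 ✓`B9Cor36GVKDivForm` for the torus cube letter); the lattice Leibniz rule moves the far-right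
`∇_μ` onto `G_□(1)` at the price of the commutators `[W_μ, ∇_μ]`, `W_μ = V¹_μ + P¹_μ`, which G-F8a ✓`hasMajorant_commV1Y` ∕ ✓`hasMajorant_commP1Y` majorise from the
VARIATION window `‖Ṽ_a(y − e_ν) − Ṽ_a(y)‖ ≤ α(η∕len a)²` and the PLAQUETTE window `‖Re Ṽ(∂p) − 1‖ ≤ α(η∕len a)²` in the block neighbourhood of graph radius **3**
(one more lattice step than the letters themselves).  F3 ✓`hW2_cut` ∕ ✓`hW3_cut` give these windows at radius 2 (for ✓`hasMajorant_V0Y∕V1Y∕P0Y∕P1Y`).  THIS FILE: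
§1 the level slack at any block distance `< RM1` (blocks closer than `RM1 = R·L·M_h − 1` differ by at most one level, [4] (2.2)∕(2.60) for the cube sequence —
✓`levelGap_geoCK`), in particular at distance `≤ 3` once `3 < RM1`; §2 ★`hW2_cut3` ∕ ★`hW3_cut3` — F3's windows VERBATIM at radius 3 (same constant
`α_T = alphaW(2CΛ²)·L²`, same proofs with §1's slack); §3 ★★`hasMajorant_commV1Y_cutCfgS` ∕ ★★`hasMajorant_commP1Y_cutCfgS` — G-F8a at the sharp-cut field (the
Dirichlet twins of p38's ✓`hasMajorant_commV1Y_locCfgY` ∕ ✓`hasMajorant_commP1Y_locCfgY`, whose windows were uniform on the torus).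

WHAT IS PROVED (0 `def`s; theorems; 0 sorry; 0 new named facts; standard axioms): §1 `scale_sub_le_one_of_dist_lt_RM1`, `len_le_L_mul_len_of_dist_lt_RM1`,
`len_le_L_mul_len_of_dSite_three`; §2 ★`hW2_cut3`, ★`hW3_cut3`; §3 ★★`hasMajorant_commV1Y_cutCfgS`, ★★`hasMajorant_commP1Y_cutCfgS`.

HONEST SCOPE ∕ NOT CLAIMED.  Transcription: F3's window proofs at radius 3 and G-F8a's commutator theorems BY NAME; DISPLAYED: the (3.35)∕(3.37) datum of the cut
(`hC … hdA`, `hS2`), the member threshold `3 < RM1 i`, the bi-contractivity `hU` of `Ṽ` (F3 ✓`unitaryLike_cutCfgS_of_unitary` for unitary data), `α_T ≤ 1`.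
No propagator estimate here (R3 consumes these letters).  Nothing on `d = 4`, the continuum, reflection positivity or the mass gap; NOT a node discharge;
count-neutral; no row head changes.  NEW file; nothing landed is modified.  `--supports stmt-QuantumFields-27239`.

RELATED IN THE TREE, NOT DUPLICATED (searched 2026-08-31: `rg 'hW2_cut3|hW3_cut3|commV1Y_cutCfgS|dist_lt_RM1'` over `Literature/` + `Summits/` = ∅): F3 ✓`B9Cor36GDirCutWindows`
(radius 2; USED: `readings_cut`, `norm_cutFldS_le_blk`, `eta_mul_norm_cutFldS_le`, `cutCfgS_eq_prodCfg`), ✓`B9Cor36GCubeWindowsPointwise` (`scale_sub_le_one_of_dist_le_two`,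
the radius-2 slack; pointwise window engines USED), G-F8a ✓`B9Ineq373FirstOrderCommY` (USED), p38's §6 there (the smooth-cutoff twins).
-/

noncomputable section

namespace Literature.MathematicalPhysics.QuantumFieldTheory.Balaban1983to89.B9Cor36GDirCutWindowsThree

open NormedSpace Complex
open B6RandomWalk (HasMajorant)
open B9Thm34Ext (toB6)
open B6KLevelCensusIndexV1 (KIdx kGeo)
open B6GlobalChartV1 (PV boxEquiv)
open B6Cover236MultiLevelBlocks (cubes)
open B9Eq39Adjoint (prodCfg covD covDstar)
open B9BackgroundsKLevelV1 (shiftsV1)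
open B9Eq337CutFieldDirY (cutFldS cutCfgS)
open B9Eq360DeltaPrimeAY (AfldY chartA chartA_apply)
open B9CubeLettersOpsL0 (cubeFamY levCubeY)
open B9CubeLettersBondOpsL0 (BlkCubeY)
open B9Eq360DeltaPrimeACubeY (blkCubeY)
open B9CubeGeometryInputs (geoCK geoCK_len geoCK_len_pos geoCK_eta geoCK_eta_pos geoCK_eta_le_len geoCK_dist_axioms RM1 RM1_nonneg levelGap_geoCK)
open B9Cor36GCubeWindows (alphaW alphaW_nonneg mul_exp_le_alphaW exp_mul_le_alphaW unitaryLike_holY)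
open B9Cor36GCubeWindowsPointwise (norm_prodCfg_one_sub_le norm_holY_prodCfg_sub_one_le norm_reHolY_imHolY_le)
open B9Cor36GDirCutWindows (cutCfgS_eq_prodCfg readings_cut norm_cutFldS_le_blk eta_mul_norm_cutFldS_le)
open B9Ineq373HessianPieceBoundsY (dSite)
open B9Ineq373FirstOrderCommY (cK1 hasMajorant_commV1Y hasMajorant_commP1Y)
open B9Ineq375GradDivBoundsY (cP1)
open B9Cor35GCubeInputsAtOne (blkBK DK)
open B9Eq371CoCurlLeibnizY (V1Y)
open B9Eq375GradDivSplitY (P1Y)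
open Node00 (SiteY CfgY PlaqY toKT shiftY holY reHolY imHolY)
open Node00.OpsYNablaBridge (chartY shiftY_chartY shiftY_symm_chartY)
open scoped Matrix Matrix.Norms.L2Operator

variable {d ℓ : ℕ} {hd : 1 ≤ d + 1} {hL : Odd (ℓ + 1) ∧ 1 < ℓ + 1} {b₀ b₁ : ℝ}
variable {𝔸 : Type} [NormedRing 𝔸] [NormedAlgebra ℂ 𝔸] [CompleteSpace 𝔸]

/-! ## §1  Level slack below the collar width: blocks at graph distance `< RM1` differ by at most one level -/

section Slack

variable (i : KIdx d ℓ hd hL b₀ b₁) (c : ↥(cubes (toKT i).D.toDomains))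

/-- ★ blocks at block-graph distance `< RM1 = R·L·M_h − 1` have levels differing by `≤ 1` ([4] (2.2)∕(2.60) for the cube sequence, ✓`levelGap_geoCK`:
`RM1·max(|Δlev| − 1, 0) ≤ d(a, a′)`). [cite: Balaban1984PropagatorsII, (2.2) p.224, Lemma 2.1 (2.60) p.234; Balaban1985BackgroundPropagators, p.408 («This sequence satisfies the conditions (2.1), (2.2)»)] -/
theorem scale_sub_le_one_of_dist_lt_RM1 {a a' : BlkCubeY i c} (h : (geoCK i c).dist a a' < RM1 i) :
    |((a.1.1 : ℕ) : ℝ) - ((a'.1.1 : ℕ) : ℝ)| ≤ 1 := by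
  have hg := levelGap_geoCK i c a a'
  change RM1 i * max (|((a.1.1 : ℕ) : ℝ) - ((a'.1.1 : ℕ) : ℝ)| - 1) 0 ≤ (geoCK i c).dist a a' at hg
  by_contra hlt
  push Not at hlt
  -- the level difference is an integer `≥ 2`
  have hint : (2 : ℝ) ≤ |((a.1.1 : ℕ) : ℝ) - ((a'.1.1 : ℕ) : ℝ)| := by
    have e : |((a.1.1 : ℕ) : ℝ) - ((a'.1.1 : ℕ) : ℝ)| = (((|(a.1.1 : ℤ) - (a'.1.1 : ℤ)| : ℤ)) : ℝ) := by push_cast; rfl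
    rw [e] at hlt ⊢
    have h1 : (1 : ℤ) < |(a.1.1 : ℤ) - (a'.1.1 : ℤ)| := by exact_mod_cast hlt
    exact_mod_cast h1
  have hmax : (1 : ℝ) ≤ max (|((a.1.1 : ℕ) : ℝ) - ((a'.1.1 : ℕ) : ℝ)| - 1) 0 := le_max_of_le_left (by linarith)
  have : RM1 i * 1 ≤ RM1 i * max (|((a.1.1 : ℕ) : ℝ) - ((a'.1.1 : ℕ) : ℝ)| - 1) 0 := mul_le_mul_of_nonneg_left hmax (RM1_nonneg i)
  linarith

/-- ★ hence their lengths differ by at most one factor `L`: `len(a′) ≤ L·len(a)`. [cite: Balaban1984PropagatorsII, (2.2) p.224, (2.16) p.225] -/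
theorem len_le_L_mul_len_of_dist_lt_RM1 {a a' : BlkCubeY i c} (h : (geoCK i c).dist a a' < RM1 i) :
    (geoCK i c).len a' ≤ ((ℓ : ℝ) + 1) * (geoCK i c).len a := by
  have hs := scale_sub_le_one_of_dist_lt_RM1 i c h
  have hle : (a'.1.1 : ℕ) ≤ a.1.1 + 1 := by
    have h1 : ((a'.1.1 : ℕ) : ℝ) - ((a.1.1 : ℕ) : ℝ) ≤ 1 := by
      have := neg_abs_le (((a.1.1 : ℕ) : ℝ) - ((a'.1.1 : ℕ) : ℝ)); linarith
    have h2 : ((a'.1.1 : ℕ) : ℝ) ≤ ((a.1.1 + 1 : ℕ) : ℝ) := by push_cast; linarith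
    exact_mod_cast h2
  rw [geoCK_len, geoCK_len]
  have hη := geoCK_eta_pos i c
  rw [geoCK_eta] at hη
  have hL1 : (1 : ℝ) ≤ (ℓ : ℝ) + 1 := by linarith [(Nat.cast_nonneg ℓ : (0 : ℝ) ≤ ℓ)]
  calc ((ℓ : ℝ) + 1) ^ a'.1.1 * (kGeo i).eta ≤ ((ℓ : ℝ) + 1) ^ (a.1.1 + 1) * (kGeo i).eta :=
        mul_le_mul_of_nonneg_right (pow_le_pow_right₀ hL1 hle) hη.le
    _ = ((ℓ : ℝ) + 1) * (((ℓ : ℝ) + 1) ^ a.1.1 * (kGeo i).eta) := by ring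

/-- ★ **LEVEL SLACK AT RADIUS 3, SYMMETRIC FORM**: for a cube block `a` and a torus site `y` at block distance `≤ 3`, `len a ≤ L·len(blk y)` once `3 < RM1 i`.
[cite: Balaban1984PropagatorsII, (2.2) p.224; Balaban1985BackgroundPropagators, p.408] -/
theorem len_le_L_mul_len_of_dSite_three (hM : 3 < RM1 i) {a : BlkCubeY i c} {y : Site (PV d ℓ i.m i.K hd hL) 0} (h : dSite i c a y ≤ 3) :
    (geoCK i c).len a ≤ ((ℓ : ℝ) + 1) * (geoCK i c).len (blkCubeY i c (chartY i y)) := by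
  obtain ⟨-, -, -, hsym⟩ := geoCK_dist_axioms i c 0 True
  refine len_le_L_mul_len_of_dist_lt_RM1 i c ?_
  rw [hsym]; exact lt_of_le_of_lt h hM

end Slack

/-! ## §2  ★ F3's windows `hW2 ∕ hW3` at radius 3 (constant `α_T = alphaW(2CΛ²)·L²` unchanged) -/

section Windows

variable (i : KIdx d ℓ hd hL b₀ b₁) (c : ↥(cubes (toKT i).D.toDomains))
variable {T : Finset (SiteY i)} {A : AfldY 𝔸 i} {Q : Set (Site (PV d ℓ i.m i.K hd hL) 0)} {C ξ Λ : ℝ}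
  (hC : 0 ≤ C) (hξ : (kGeo i).eta ≤ ξ) (hΛ : 1 ≤ Λ) (hΛξ : LatticeNorms.scaleLen ((ℓ : ℝ) + 1) (kGeo i).eta (c.1.1 + 1) ≤ Λ * ξ)
  (hQ : ∀ z ∈ T, (boxEquiv i.hN).symm z ∈ Q)
  (hA : ∀ κ, ∀ x ∈ Q, ‖A κ x‖ ≤ C * ξ⁻¹)
  (hdA : ∀ μ ν, ∀ x ∈ Q, ‖(((kGeo i).eta : ℂ)⁻¹) • covD (shiftsV1 (PV d ℓ i.m i.K hd hL)) (fun _ _ => (1 : 𝔸ˣ)) μ (A ν) x‖ ≤ C * (ξ ^ 2)⁻¹)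
  (hS2 : ∀ z : SiteY i, 1 ≤ levCubeY i c z → z ∈ T ∧ ∀ μ, shiftY i μ z ∈ T ∧ (shiftY i μ).symm z ∈ T ∧
    ∀ ν, shiftY i ν (shiftY i μ z) ∈ T ∧ shiftY i ν ((shiftY i μ).symm z) ∈ T ∧ (shiftY i ν).symm ((shiftY i μ).symm z) ∈ T)
  (hM : 3 < RM1 i)
include hC hξ hΛ hΛξ hQ hA hdA hS2 hM

section NormOne

variable [NormOneClass 𝔸]

/-- ★ **`hW2` AT THE SHARP CUT, RADIUS 3**: `‖Ṽ_{a′}(y) − Ṽ_{a′}(y − e_μ)‖ ≤ α_T·(η∕len a)²` for every cube block `a`, directions `a′, μ` and torus site `y` at block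
distance `≤ 3` from `a` (own-scale backward-difference reading × `e^{α₁}`, two factors `L` of level slack) — F3's ✓`hW2_cut` one block step further out.
[cite: Balaban1985BackgroundPropagators, Cor. 3.6 p.408, (3.37) p.396 (the `|∇^ηA′|` half), (3.73) p.405] -/
theorem hW2_cut3 :
    ∀ (a : BlkCubeY i c) (a' μ : Fin (d + 1)) (y : Site (PV d ℓ i.m i.K hd hL) 0), dSite i c a y ≤ 3 →
      ‖(cutCfgS i T (kGeo i).eta A a' y : 𝔸) - cutCfgS i T (kGeo i).eta A a' (y.unshift μ)‖ ≤
        alphaW (2 * C * Λ ^ 2) * ((ℓ : ℝ) + 1) ^ 2 * ((kGeo i).eta * ((geoCK i c).len a)⁻¹) ^ 2 := by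
  intro a a' μ y hd3
  have hη : 0 < (kGeo i).eta := by rw [← geoCK_eta i c]; exact geoCK_eta_pos i c
  have hα : 0 ≤ 2 * C * Λ ^ 2 := by positivity
  have hla := geoCK_len_pos i c a
  have hlb := geoCK_len_pos i c (blkCubeY i c (chartY i y))
  set lb := (geoCK i c).len (blkCubeY i c (chartY i y)) with hlbdef
  rw [cutCfgS_eq_prodCfg]
  refine (norm_prodCfg_one_sub_le i hη.le (cutFldS i T A) a' y (y.unshift μ) (eta_mul_norm_cutFldS_le i c hC hξ hΛ hΛξ hQ hA hdA hS2 a' y)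
    (eta_mul_norm_cutFldS_le i c hC hξ hΛ hΛξ hQ hA hdA hS2 a' (y.unshift μ))).trans ?_
  -- the backward difference at `y`'s own scale
  have hdiff : ‖cutFldS i T A a' y - cutFldS i T A a' (y.unshift μ)‖ ≤ (kGeo i).eta * (2 * C * Λ ^ 2 * (lb ^ 2)⁻¹) := by
    have h := (readings_cut i c hC hξ hΛ hΛξ hQ hA hdA hS2).1 μ a' (chartY i y)
    rw [covDstar, inv_one, B9Eq39Adjoint.R_one, shiftY_symm_chartY, chartA_apply, chartA_apply,
      show (boxEquiv i.hN).symm (chartY i y) = y from Equiv.symm_apply_apply _ _,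
      show (boxEquiv i.hN).symm (chartY i (y.unshift μ)) = y.unshift μ from Equiv.symm_apply_apply _ _, norm_smul, norm_inv, Complex.norm_real,
      Real.norm_of_nonneg hη.le, ← norm_neg, neg_sub] at h
    have h' := mul_le_mul_of_nonneg_left h hη.le
    rwa [← mul_assoc, mul_inv_cancel₀ hη.ne', one_mul, ← hlbdef] at h'
  have hslack : lb⁻¹ ≤ ((ℓ : ℝ) + 1) * ((geoCK i c).len a)⁻¹ := by
    have h := len_le_L_mul_len_of_dSite_three i c hM hd3
    rw [← hlbdef] at h
    rw [inv_le_comm₀ hlb (by positivity), mul_inv, inv_inv]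
    calc (((ℓ : ℝ) + 1))⁻¹ * (geoCK i c).len a ≤ (((ℓ : ℝ) + 1))⁻¹ * (((ℓ : ℝ) + 1) * lb) := mul_le_mul_of_nonneg_left h (by positivity)
      _ = lb := by field_simp
  have hslack2 : (lb ^ 2)⁻¹ ≤ ((ℓ : ℝ) + 1) ^ 2 * ((geoCK i c).len a)⁻¹ ^ 2 := by
    rw [← inv_pow, ← mul_pow]; exact pow_le_pow_left₀ (inv_nonneg.2 hlb.le) hslack 2
  calc (kGeo i).eta * ‖cutFldS i T A a' y - cutFldS i T A a' (y.unshift μ)‖ * Real.exp (2 * C * Λ ^ 2)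
      ≤ (kGeo i).eta * ((kGeo i).eta * (2 * C * Λ ^ 2 * (lb ^ 2)⁻¹)) * Real.exp (2 * C * Λ ^ 2) :=
        mul_le_mul_of_nonneg_right (mul_le_mul_of_nonneg_left hdiff hη.le) (Real.exp_pos _).le
    _ = (2 * C * Λ ^ 2 * Real.exp (2 * C * Λ ^ 2)) * ((kGeo i).eta ^ 2 * (lb ^ 2)⁻¹) := by ring
    _ ≤ alphaW (2 * C * Λ ^ 2) * ((kGeo i).eta ^ 2 * (((ℓ : ℝ) + 1) ^ 2 * ((geoCK i c).len a)⁻¹ ^ 2)) :=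
        mul_le_mul (mul_exp_le_alphaW hα) (mul_le_mul_of_nonneg_left hslack2 (sq_nonneg _)) (by positivity) (alphaW_nonneg hα)
    _ = alphaW (2 * C * Λ ^ 2) * ((ℓ : ℝ) + 1) ^ 2 * ((kGeo i).eta * ((geoCK i c).len a)⁻¹) ^ 2 := by ring

end NormOne

/-- ★ **`hW3` AT THE SHARP CUT, RADIUS 3** (bi-contractive `Ṽ`): `‖Re Ṽ(∂p) − 1‖, ‖Im Ṽ(∂p)‖ ≤ α_T·(η∕len a)²` for every cube block `a` and plaquette `p` whose source
is at block distance `≤ 3` from `a` — F3's ✓`hW3_cut` one block step further out. [cite: Balaban1985BackgroundPropagators, (3.69) p.404, (3.37) p.396, Cor. 3.6 p.408] -/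
theorem hW3_cut3 (hU : ∀ μ x, ‖(cutCfgS i T (kGeo i).eta A μ x : 𝔸)‖ ≤ 1 ∧ ‖(((cutCfgS i T (kGeo i).eta A μ x)⁻¹ : 𝔸ˣ) : 𝔸)‖ ≤ 1) :
    ∀ (a : BlkCubeY i c) (p : PlaqY i), dSite i c a p.src ≤ 3 →
      ‖reHolY i (cutCfgS i T (kGeo i).eta A) p - 1‖ ≤ alphaW (2 * C * Λ ^ 2) * ((ℓ : ℝ) + 1) ^ 2 * ((kGeo i).eta * ((geoCK i c).len a)⁻¹) ^ 2 ∧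
        ‖imHolY i (cutCfgS i T (kGeo i).eta A) p‖ ≤ alphaW (2 * C * Λ ^ 2) * ((ℓ : ℝ) + 1) ^ 2 * ((kGeo i).eta * ((geoCK i c).len a)⁻¹) ^ 2 := by
  intro a p hd3
  have hη : 0 < (kGeo i).eta := by rw [← geoCK_eta i c]; exact geoCK_eta_pos i c
  have hα : 0 ≤ 2 * C * Λ ^ 2 := by positivity
  have hla := geoCK_len_pos i c a
  obtain ⟨x, μ, ν, hμν⟩ := p
  have hlb := geoCK_len_pos i c (blkCubeY i c (chartY i x))
  set lb := (geoCK i c).len (blkCubeY i c (chartY i x)) with hlbdef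
  have hηl : (kGeo i).eta ≤ lb := by rw [hlbdef, ← geoCK_eta i c]; exact geoCK_eta_le_len i c _
  obtain ⟨-, r2, -⟩ := readings_cut i c hC hξ hΛ hΛξ hQ hA hdA hS2
  -- the four readings at `x`'s own scale
  have hval : ∀ κ, ‖cutFldS i T A κ x‖ ≤ 2 * C * Λ ^ 2 * lb⁻¹ := fun κ => norm_cutFldS_le_blk i c hC hξ hΛ hΛξ hQ hA hdA hS2 κ x
  have hdif : ∀ κ κ', ‖cutFldS i T A κ' (x.shift κ) - cutFldS i T A κ' x‖ ≤ (kGeo i).eta * (2 * C * Λ ^ 2 * (lb ^ 2)⁻¹) := fun κ κ' => by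
    have h := r2 κ κ' (chartY i x)
    rw [covD, B9Eq39Adjoint.R_one, shiftY_chartY, chartA_apply, chartA_apply,
      show (boxEquiv i.hN).symm (chartY i x) = x from Equiv.symm_apply_apply _ _,
      show (boxEquiv i.hN).symm (chartY i (x.shift κ)) = x.shift κ from Equiv.symm_apply_apply _ _, norm_smul, norm_inv, Complex.norm_real,
      Real.norm_of_nonneg hη.le] at h
    have h' := mul_le_mul_of_nonneg_left h hη.le
    rwa [← mul_assoc, mul_inv_cancel₀ hη.ne', one_mul, ← hlbdef] at h'
  have hhol : ‖(holY i (cutCfgS i T (kGeo i).eta A) ⟨x, μ, ν, hμν⟩ : 𝔸) - 1‖ ≤ alphaW (2 * C * Λ ^ 2) * ((kGeo i).eta * lb⁻¹) ^ 2 := by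
    rw [cutCfgS_eq_prodCfg]
    refine (norm_holY_prodCfg_sub_one_le i hη hηl (cutFldS i T A) x hμν (hval μ) (hval ν) (hdif μ ν) (hdif ν μ)).trans ?_
    rw [div_eq_mul_inv]
    have ht : (kGeo i).eta * lb⁻¹ ≤ 1 := by rw [← div_eq_mul_inv, div_le_one hlb]; exact hηl
    exact mul_le_mul_of_nonneg_right (exp_mul_le_alphaW hα ht) (sq_nonneg _)
  have hslack : lb⁻¹ ≤ ((ℓ : ℝ) + 1) * ((geoCK i c).len a)⁻¹ := by
    have h := len_le_L_mul_len_of_dSite_three i c hM hd3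
    rw [← hlbdef] at h
    rw [inv_le_comm₀ hlb (by positivity), mul_inv, inv_inv]
    calc (((ℓ : ℝ) + 1))⁻¹ * (geoCK i c).len a ≤ (((ℓ : ℝ) + 1))⁻¹ * (((ℓ : ℝ) + 1) * lb) := mul_le_mul_of_nonneg_left h (by positivity)
      _ = lb := by field_simp
  have hsq : ((kGeo i).eta * lb⁻¹) ^ 2 ≤ ((ℓ : ℝ) + 1) ^ 2 * ((kGeo i).eta * ((geoCK i c).len a)⁻¹) ^ 2 := by
    rw [← mul_pow]
    refine pow_le_pow_left₀ (by positivity) ?_ 2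
    calc (kGeo i).eta * lb⁻¹ ≤ (kGeo i).eta * (((ℓ : ℝ) + 1) * ((geoCK i c).len a)⁻¹) := mul_le_mul_of_nonneg_left hslack hη.le
      _ = ((ℓ : ℝ) + 1) * ((kGeo i).eta * ((geoCK i c).len a)⁻¹) := by ring
  have hw : ‖(holY i (cutCfgS i T (kGeo i).eta A) ⟨x, μ, ν, hμν⟩ : 𝔸) - 1‖ ≤
      alphaW (2 * C * Λ ^ 2) * ((ℓ : ℝ) + 1) ^ 2 * ((kGeo i).eta * ((geoCK i c).len a)⁻¹) ^ 2 :=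
    hhol.trans (by rw [mul_assoc (alphaW _) (((ℓ : ℝ) + 1) ^ 2)]; exact mul_le_mul_of_nonneg_left hsq (alphaW_nonneg hα))
  have hh := (T4RelativeLadder.unitaryLike_iff _).1 (unitaryLike_holY i hU ⟨x, μ, ν, hμν⟩)
  have hri := norm_reHolY_imHolY_le i (cutCfgS i T (kGeo i).eta A) ⟨x, μ, ν, hμν⟩ hh.2
  exact ⟨hri.1.trans hw, hri.2.trans hw⟩

/-! ## §3  ★★ The two first-order commutator letters of `Δ_{loc,□}(1) − Δ_{loc,□}(Ṽ)` at the sharp-cut field: zeroth order, (3.73)-size `O(1)·α_T·(Lⁿη)⁻²` -/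

variable [NormOneClass 𝔸]
variable {ιb : Type} [Fintype ιb] (b : Module.Basis ιb ℝ 𝔸) {M₂ : ℝ} (hM₂ : 0 ≤ M₂) (hrepr : ∀ (v : 𝔸) (j : ιb), |b.repr v j| ≤ M₂ * ‖v‖)
  (hU : ∀ μ x, ‖(cutCfgS i T (kGeo i).eta A μ x : 𝔸)‖ ≤ 1 ∧ ‖(((cutCfgS i T (kGeo i).eta A μ x)⁻¹ : 𝔸ˣ) : 𝔸)‖ ≤ 1)
include hM₂ hrepr hU

/-- ★★ **THE `V¹`-COMMUTATOR LETTER AT THE SHARP-CUT FIELD** (`α_T ≤ 1`): for all directions `μ, ν`,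
`conj b(V¹_μ(Ṽ))·DK ν − DK ν·conj b(V¹_μ(Ṽ)) ≺ (M₂Σ‖b_j‖)·c_{K1}(d)·e^{3δ}·α_T·(len(a)²)⁻¹·e^{−δd(a,a′)}` over `toB6 (geoCK i □) Rr H` — G-F8a ✓`hasMajorant_commV1Y` at
§2's radius-3 windows; the `V₁`-half of print's «local differential operator of the first order satisfying (3.73)» read in divergence form.
[cite: Balaban1985BackgroundPropagators, (3.73) p.405, (3.37) p.396, Cor. 3.6 p.408, (3.85)–(3.86) p.407, p.398 l.20–24; Balaban1984PropagatorsII, (2.51) p.232] -/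
theorem hasMajorant_commV1Y_cutCfgS (hαT1 : alphaW (2 * C * Λ ^ 2) * ((ℓ : ℝ) + 1) ^ 2 ≤ 1) {δ : ℝ} (hδ : 0 ≤ δ) (Rr : ℝ) (H : Prop) (μ ν : Fin (d + 1)) :
    HasMajorant (g := toB6 (geoCK i c) Rr H) (blkBK i c)
      (B9Eq352DivFormLetters.conj b ((V1Y i (cutCfgS i T (kGeo i).eta A) μ).restrictScalars ℝ) * DK b i ν -
        DK b i ν * B9Eq352DivFormLetters.conj b ((V1Y i (cutCfgS i T (kGeo i).eta A) μ).restrictScalars ℝ))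
      (fun a a' => (M₂ * ∑ j, ‖b j‖) *
        (cK1 d * Real.exp (3 * δ) * (alphaW (2 * C * Λ ^ 2) * ((ℓ : ℝ) + 1) ^ 2) * ((geoCK i c).len a ^ 2)⁻¹ * Real.exp (-(δ * (geoCK i c).dist a a')))) := by
  have hα : 0 ≤ 2 * C * Λ ^ 2 := by positivity
  have hαT0 : 0 ≤ alphaW (2 * C * Λ ^ 2) * ((ℓ : ℝ) + 1) ^ 2 := mul_nonneg (alphaW_nonneg hα) (sq_nonneg _)
  refine hasMajorant_commV1Y i c b hU hM₂ hrepr hαT0 hαT1 ν (fun a a' y hy => ?_) (fun a p hp => ?_) hδ Rr H μ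
  · rw [norm_sub_rev]; exact hW2_cut3 i c hC hξ hΛ hΛξ hQ hA hdA hS2 hM a a' ν y hy
  · exact (hW3_cut3 i c hC hξ hΛ hΛξ hQ hA hdA hS2 hM hU a p hp).1

/-- ★★ **THE `P¹`-COMMUTATOR LETTER AT THE SHARP-CUT FIELD**: for all directions `μ, ν`,
`conj b(P¹_μ(Ṽ))·DK ν − DK ν·conj b(P¹_μ(Ṽ)) ≺ (M₂Σ‖b_j‖)·c_{P1}(d)·e^{3δ}·α_T·(len(a)²)⁻¹·e^{−δd(a,a′)}` over `toB6 (geoCK i □) Rr H` — G-F8a ✓`hasMajorant_commP1Y` at §2's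
radius-3 variation window; the `V₂`-half of print's first-order operator read in divergence form.
[cite: Balaban1985BackgroundPropagators, (3.73) p.405, (3.75) p.405, (3.37) p.396, Cor. 3.6 p.408, (3.85)–(3.86) p.407; Balaban1984PropagatorsII, (2.51) p.232] -/
theorem hasMajorant_commP1Y_cutCfgS {δ : ℝ} (hδ : 0 ≤ δ) (Rr : ℝ) (H : Prop) (μ ν : Fin (d + 1)) :
    HasMajorant (g := toB6 (geoCK i c) Rr H) (blkBK i c)
      (B9Eq352DivFormLetters.conj b ((P1Y i (cutCfgS i T (kGeo i).eta A) μ).restrictScalars ℝ) * DK b i ν -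
        DK b i ν * B9Eq352DivFormLetters.conj b ((P1Y i (cutCfgS i T (kGeo i).eta A) μ).restrictScalars ℝ))
      (fun a a' => (M₂ * ∑ j, ‖b j‖) *
        (cP1 d * Real.exp (3 * δ) * (alphaW (2 * C * Λ ^ 2) * ((ℓ : ℝ) + 1) ^ 2) * ((geoCK i c).len a ^ 2)⁻¹ * Real.exp (-(δ * (geoCK i c).dist a a')))) := by
  have hα : 0 ≤ 2 * C * Λ ^ 2 := by positivity
  have hαT0 : 0 ≤ alphaW (2 * C * Λ ^ 2) * ((ℓ : ℝ) + 1) ^ 2 := mul_nonneg (alphaW_nonneg hα) (sq_nonneg _)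
  refine hasMajorant_commP1Y i c b hU hM₂ hrepr hαT0 ν (fun a a' y hy => ?_) hδ Rr H μ
  rw [norm_sub_rev]; exact hW2_cut3 i c hC hξ hΛ hΛξ hQ hA hdA hS2 hM a a' ν y hy

end Windows

end Literature.MathematicalPhysics.QuantumFieldTheory.Balaban1983to89.B9Cor36GDirCutWindowsThree

end
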